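import Literature.Topology.FourManifolds.GluckTwist
import Literature.Topology.FourManifolds.ImmersionCriterion
import Literature.Topology.FourManifolds.DehnSurgeryTubularNbhdProofs
import Mathlib.Analysis.Complex.Polynomial.Basic
import HarnessLib

/-!
# Branched double covers of `S⁴` along a 2-knot and their deck involutions (relational form)

Topic `Literature/Topology/FourManifolds`. A DEFINITION file: the notion "`(X, ι, q)` is a
double cover of `S⁴` branched along the 2-knot `K`, with deck (branching) involution `ι` and
projection `q`" — the object `Σ₂(S⁴, K)` of 2-knot theory (Gompf–Stipsicz, *4-Manifolds and
Kirby Calculus* (1999), §6.3; Zeeman, *Twisting spun knots*, Trans. AMS 115 (1965), §6;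
Miyazawa, arXiv:2312.02041, §3; Kuhrman, arXiv:2507.03798, §2.2 eq. (1)) — requested informally
by route `SmoothPoincare4/ChargedHalfTurns` ("DEFINITION REQUESTS … wanted later: branched double
covers of `S⁴` along 2-knots") and the first object (`S0` of the seat's census) in the printed
proof of the named fact `Kuhrman2025_thm3_chargedHomotopySphere` (`ChargedHomotopySphere.lean`),
whose witnesses are the deck involutions of `Σ₂(S⁴, ρK(2,3,|6s+1|))`.

## The construction being axiomatised

For a smooth 2-knot `K : S² ↪ S⁴` with (trivial, open) tubular neighbourhood
`ν : S² × ℝ² ↪ S⁴` (`TwoKnot.TubularNbhd`, existence `TwoKnot.nonempty_tubularNbhd_holds`), the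
branched double cover is `Σ₂(S⁴, K) = Ỹ ∪ (S² × ℝ²)`, where `Ỹ → S⁴ ∖ K(S²)` is the connected
double cover (classified by `H₁(S⁴ ∖ K; ℤ) = ℤ → ℤ/2`) and `S² × ℝ²` is glued in over `ν` by the
squaring map of the normal plane, `(p, w) ↦ ν (p, w²)` (`w ∈ ℝ² ≅ ℂ`); the deck involution `ι`
is the non-trivial deck transformation on `Ỹ` and `(p, w) ↦ (p, -w)` on `S² × ℝ²`; its
fixed-point set is the lifted knot `S² × {0} ≅ S²` and the projection `q : Σ₂ → S⁴` is smooth,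
a local diffeomorphism off the fixed set, and of rank `2` along it (Gompf–Stipsicz §6.3;
Bredon, *Introduction to compact transformation groups* (1972), VI.2 for the equivariant
tubular neighbourhood giving uniqueness of this smooth structure).

## What is defined (relational, no quotient or gluing type is built — the tree's design for
`IsGluckTwist`, `IsConnectedSum`, `IsBranchedDoubleQuotient`)

* `normalSq : ℝ² → ℝ²`, `(u, v) ↦ (u² - v², 2uv)` — the squaring map `w ↦ w²` of `ℂ ≅ ℝ²`, the
  branching model in the normal plane; proved: `normalSq (-w) = normalSq w`, its fibres are
  EXACTLY `{w, -w}` (`normalSq_eq_normalSq_iff`), `normalSq w = 0 ↔ w = 0`, it is onto and `C^∞`.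
* `IsBranchedDoubleCover IX X K ι q` — for `X` a manifold modelled on `IX`, `K : TwoKnot`,
  `ι : X → X`, `q : X → 𝕊 4`: `q` and `ι` are `C^∞`; `q ∘ ι = q`; the fibres of `q` are exactly the
  `ι`-orbits; `q` is onto; off the knot (`q x ∉ K(S²)`) `ι` is free and `q` is a local
  diffeomorphism; and over some tubular neighbourhood `ν` of `K` the triple is THE MODEL: an open
  smooth embedding `j : S² × ℝ² ↪ X` with `q (j (p, w)) = ν (p, w²)`, `ι (j (p, w)) = j (p, -w)`
  and `j (S² × ℝ²) = q⁻¹(ν(S² × ℝ²))`.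

## What is proved here (API; no named facts)

`ι` is an involution (`deck_deck`, `deck_involutive`: forced by the fibre clause), `q⁻¹` of the
knot is exactly the fixed-point set of `ι` (`isFixedPt_iff`), and — the planner's `FixedSphere` —
**the fixed-point set of the deck involution is a smoothly embedded 2-sphere lifting the knot**
(`exists_isSmoothEmbedding_fixedPoints`: `e p = j (p, 0)` is an injective immersion of the
compact `S²`, by the tree's immersion criterion `isSmoothEmbedding_of_injective_of_injective_
mfderiv` and `mfderiv_injective_of_isImmersion`), in exactly the binder shape of
`Kuhrman2025_thm3_chargedHomotopySphere` / route item `ChargedSphere`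
(`Manifold.IsSmoothEmbedding (𝓡 2) IX ∞ e ∧ ∀ x, ι x = x ↔ x ∈ range e`).

Deliberately NOT here (theorems about the predicate, each a cited result for a later file):
EXISTENCE of `(X, ι, q)` for every 2-knot and uniqueness up to equivariant diffeomorphism
(Gompf–Stipsicz §6.3, Bredon VI.2), compactness / simple connectivity / homology of `X`,
`Σ₂(S⁴, unknot) = S⁴` with the linear half-turn (Miyazawa Prop. 3.14), and everything about
twist- or roll-spun knots (Kuhrman Thm. 1, Miyazawa Thm. 4.44).

## Mathlib / tree search

Mathlib: no branched coverings (`lean search 'branched|Branched'` finds only this tree);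
`IsCoveringMap`, `IsLocalDiffeomorphAt`, `Manifold.IsSmoothEmbedding`, `Function.IsFixedPt`.
Tree: `TwoKnot`, `TwoKnot.TubularNbhd` (`Knots.lean`, `GluckTwist.lean`); the conj-quotient
predicate `IsBranchedDoubleQuotient` (`BranchedDoubleQuotient.lean`: cover modelled on `ℂ²`,
quotient a bare 4-manifold, branch locus a real surface — the opposite bookkeeping, not reusable
for a cover OF `S⁴` along a given 2-knot) and its local model `sqModel (u, z) = (u, z²)`
(`BranchedModelCalculus.lean`, on `ℝ² × ℂ`); the cyclic branched-cover clause inlined in route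
`QuotientSpheres`. `normalSq` is the same squaring map written on the tree's normal plane
`EuclideanSpace ℝ (Fin 2)` of `TwoKnot.TubularNbhd`.

## References

* R. E. Gompf, A. I. Stipsicz, *4-Manifolds and Kirby Calculus*, AMS GSM 20 (1999), §6.3
  (branched covers; `Σ₂` of a 2-knot). [GompfStipsicz1999]
* G. E. Bredon, *Introduction to compact transformation groups*, Academic Press (1972), VI.2.
  [Bredon1972]
* J. Miyazawa, arXiv:2312.02041 (2023), §3 and Prop. 3.14. [Miyazawa2023]
* J. Kuhrman, arXiv:2507.03798 (2025), §2.2, eq. (1). [Kuhrman2025]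
-/

open scoped Manifold ContDiff Topology
open Function Set

noncomputable section

namespace Literature.Topology.FourManifolds

/-- Local notation: `𝔼 n` is the model Euclidean space `EuclideanSpace ℝ (Fin n)`. -/
local notation "𝔼 " n:arg => EuclideanSpace ℝ (Fin n)

/-- Local notation: `𝕊 n` is the unit sphere in `EuclideanSpace ℝ (Fin (n + 1))`. -/
local notation "𝕊 " n:arg => (Metric.sphere (0 : EuclideanSpace ℝ (Fin (n + 1))) 1)

/-! ## The branching model: the squaring map of the normal plane -/

/-- The **squaring map of the normal plane** `ℝ² ≅ ℂ`, `w ↦ w²`, in real coordinates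
`(u, v) ↦ (u² - v², 2uv)`: the local model, in the normal directions, of the projection of a
double cover branched along a codimension-2 submanifold (Gompf–Stipsicz (1999), §6.3;
the tree's `sqModel` of `BranchedModelCalculus.lean` on `ℝ² × ℂ`). [folklore] -/
def normalSq (w : 𝔼 2) : 𝔼 2 :=
  WithLp.toLp 2 ![w 0 ^ 2 - w 1 ^ 2, 2 * w 0 * w 1]

/-- First coordinate of the squaring map: `u² - v²`. [folklore] -/
@[simp]
theorem normalSq_apply_zero (w : 𝔼 2) : normalSq w 0 = w 0 ^ 2 - w 1 ^ 2 := rfl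

/-- Second coordinate of the squaring map: `2uv`. [folklore] -/
@[simp]
theorem normalSq_apply_one (w : 𝔼 2) : normalSq w 1 = 2 * w 0 * w 1 := rfl

/-- The squaring map is even: `(-w)² = w²`. [folklore] -/
@[simp]
theorem normalSq_neg (w : 𝔼 2) : normalSq (-w) = normalSq w := by
  ext i
  fin_cases i <;> simp [normalSq]

/-- `0² = 0`. [folklore] -/
@[simp]
theorem normalSq_zero : normalSq 0 = 0 := by
  ext i
  fin_cases i <;> simp [normalSq]

/-- The complex number `u + iv` of a point `(u, v)` of the normal plane (a private bookkeeping
device for the fibre computation). [folklore] -/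
def normalToComplex (w : 𝔼 2) : ℂ := ⟨w 0, w 1⟩

/-- `normalToComplex` is injective. [folklore] -/
theorem normalToComplex_injective : Injective normalToComplex := by
  intro w w' h
  have h0 : w 0 = w' 0 := congrArg Complex.re h
  have h1 : w 1 = w' 1 := congrArg Complex.im h
  ext i
  fin_cases i
  · exact h0
  · exact h1

/-- `normalToComplex (-w) = - normalToComplex w`. [folklore] -/
theorem normalToComplex_neg (w : 𝔼 2) : normalToComplex (-w) = -normalToComplex w :=
  Complex.ext (by simp [normalToComplex]) (by simp [normalToComplex])

/-- In the complex coordinate the squaring map is `z ↦ z²`. [folklore] -/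
theorem normalToComplex_normalSq (w : 𝔼 2) :
    normalToComplex (normalSq w) = normalToComplex w ^ 2 :=
  Complex.ext (by simp [normalToComplex, normalSq, sq]) (by simp [normalToComplex, normalSq, sq]; ring)

/-- **The fibres of the squaring map are exactly the pairs `±w`**: `w'² = w² ↔ w' = w ∨ w' = -w`
(in `ℂ`, `z'² = z²` iff `z' = ±z`). This is what makes the model `2 : 1` off the branch locus
and `1 : 1` on it. [folklore] -/
theorem normalSq_eq_normalSq_iff {w w' : 𝔼 2} :
    normalSq w' = normalSq w ↔ w' = w ∨ w' = -w := by
  constructor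
  · intro h
    have hc : normalToComplex w' ^ 2 = normalToComplex w ^ 2 := by
      rw [← normalToComplex_normalSq, ← normalToComplex_normalSq, h]
    rcases sq_eq_sq_iff_eq_or_eq_neg.mp hc with hc | hc
    · exact Or.inl (normalToComplex_injective hc)
    · refine Or.inr (normalToComplex_injective ?_)
      rw [hc, normalToComplex_neg]
  · rintro (rfl | rfl)
    · rfl
    · exact normalSq_neg w

/-- The squaring map vanishes only at the origin. [folklore] -/
theorem normalSq_eq_zero_iff {w : 𝔼 2} : normalSq w = 0 ↔ w = 0 := by
  have h := normalSq_eq_normalSq_iff (w := 0) (w' := w)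
  rwa [normalSq_zero, neg_zero, or_self] at h

/-- The squaring map is onto (every complex number has a square root). [folklore] -/
theorem normalSq_surjective : Surjective normalSq := by
  intro t
  obtain ⟨z, hz⟩ := IsAlgClosed.exists_pow_nat_eq (normalToComplex t) two_pos
  refine ⟨WithLp.toLp 2 ![z.re, z.im], normalToComplex_injective ?_⟩
  rw [normalToComplex_normalSq, ← hz]
  rfl

/-- The squaring map is `C^∞` (polynomial). [folklore] -/
theorem contDiff_normalSq : ContDiff ℝ ∞ normalSq := by
  rw [contDiff_euclidean]
  have h0 : ContDiff ℝ ∞ fun w : 𝔼 2 => w 0 := contDiff_euclidean.1 contDiff_id 0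
  have h1 : ContDiff ℝ ∞ fun w : 𝔼 2 => w 1 := contDiff_euclidean.1 contDiff_id 1
  intro i
  fin_cases i
  · exact (h0.pow 2).sub (h1.pow 2)
  · exact (contDiff_const.mul h0).mul h1

/-- In the model piece of a branched double cover, a point is fixed by the deck map iff its
normal coordinate vanishes: `ι (j (p, w)) = j (p, w) ↔ w = 0`, for `j` injective with
`ι (j (p, w)) = j (p, -w)` (over `ℝ`, `-w = w ↔ w = 0`). [folklore] -/
theorem model_isFixedPt_iff {X : Type*} {ι : X → X} {j : (𝕊 2) × 𝔼 2 → X} (hj : Injective j)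
    (hιj : ∀ p w, ι (j (p, w)) = j (p, -w)) (p : 𝕊 2) (w : 𝔼 2) :
    ι (j (p, w)) = j (p, w) ↔ w = 0 := by
  rw [hιj, hj.eq_iff, Prod.mk.injEq, neg_eq_iff_add_eq_zero, ← two_smul ℝ w,
    smul_eq_zero, and_iff_right rfl, or_iff_right (two_ne_zero' ℝ)]

/-! ## Branched double covers of `S⁴` along a 2-knot -/

variable {EX HX : Type*} [NormedAddCommGroup EX] [NormedSpace ℝ EX] [TopologicalSpace HX]

/-- **Branched double cover of `S⁴` along a 2-knot, with its deck involution** (relational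
form). `IsBranchedDoubleCover IX X K ι q` says that the manifold `X` (modelled on `IX`) together
with `ι : X → X` and `q : X → S⁴` *is* the double cover `Σ₂(S⁴, K) → S⁴` of the 4-sphere
branched along the 2-knot `K`, with branching (deck) involution `ι`:

* `q` and `ι` are `C^∞` and `q ∘ ι = q`;
* the fibres of `q` are exactly the `ι`-orbits (`q y = q x ↔ y = x ∨ y = ι x`), and `q` is onto;
* off the knot, `ι` is free and `q` is a local diffeomorphism (an unbranched double covering of
  `S⁴ ∖ K(S²)`);
* near the knot the triple is the standard model: for some tubular neighbourhood
  `ν : S² × ℝ² ↪ S⁴` of `K` there is an open smooth embedding `j : S² × ℝ² ↪ X` onto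
  `q⁻¹(ν(S² × ℝ²))` in which `q` is the squaring map of the normal plane,
  `q (j (p, w)) = ν (p, w²)`, and `ι` is `w ↦ -w`.

Gompf–Stipsicz, *4-Manifolds and Kirby Calculus* (1999), §6.3; Zeeman (1965), §6; Kuhrman,
arXiv:2507.03798, §2.2 (1); Miyazawa, arXiv:2312.02041, §3. Smoothness of the structure maps is
part of the predicate; the manifold axioms (`IsManifold IX ∞ X`), Hausdorffness and existence /
uniqueness of `(X, ι, q)` are not (consumers assume them, as for `IsGluckTwist`).
[cite: GompfStipsicz1999, §6.3] -/
structure IsBranchedDoubleCover (IX : ModelWithCorners ℝ EX HX) (X : Type*) [TopologicalSpace X]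
    [ChartedSpace HX X] (K : TwoKnot) (ι : X → X) (q : X → 𝕊 4) : Prop where
  /-- The projection is `C^∞`. -/
  contMDiff_proj : ContMDiff IX (𝓡 4) ∞ q
  /-- The deck involution is `C^∞`. -/
  contMDiff_deck : ContMDiff IX IX ∞ ι
  /-- The deck involution preserves the fibres: `q ∘ ι = q`. -/
  proj_deck : ∀ x, q (ι x) = q x
  /-- The fibres of `q` are contained in (hence equal to) the `ι`-orbits. -/
  eq_or_eq_deck_of_proj_eq : ∀ x y, q y = q x → y = x ∨ y = ι x
  /-- The projection is onto `S⁴`. -/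
  proj_surjective : Surjective q
  /-- Off the knot the deck involution is free. -/
  deck_ne_of_notMem : ∀ x, q x ∉ range K → ι x ≠ x
  /-- Off the knot the projection is a local diffeomorphism. -/
  isLocalDiffeomorphAt_proj : ∀ x, q x ∉ range K → IsLocalDiffeomorphAt IX (𝓡 4) ∞ q x
  /-- Near the knot the triple is the squaring model over a tubular neighbourhood. -/
  exists_model : ∃ (ν : TwoKnot.TubularNbhd K) (j : (𝕊 2) × 𝔼 2 → X),
    Manifold.IsSmoothEmbedding ((𝓡 2).prod 𝓘(ℝ, 𝔼 2)) IX ∞ j ∧ IsOpen (range j) ∧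
      (∀ p w, q (j (p, w)) = ν.toFun (p, normalSq w)) ∧ (∀ p w, ι (j (p, w)) = j (p, -w)) ∧
      range j = q ⁻¹' range ν.toFun

namespace IsBranchedDoubleCover

variable {IX : ModelWithCorners ℝ EX HX} {X : Type*} [TopologicalSpace X] [ChartedSpace HX X]
  {K : TwoKnot} {ι : X → X} {q : X → 𝕊 4}

/-- **The deck transformation is an involution**: `ι (ι x) = x`. Forced by the fibre clause:
`x` and `ι (ι x)` lie in the fibre of `ι x`, which is `{ι x, ι (ι x)}` and also `{x, ι x}`.
Gompf–Stipsicz (1999), §6.3. [cite: GompfStipsicz1999, §6.3] -/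
theorem deck_deck (h : IsBranchedDoubleCover IX X K ι q) (x : X) : ι (ι x) = x := by
  rcases h.eq_or_eq_deck_of_proj_eq (ι x) x (h.proj_deck x).symm with hx | hx
  · -- `x = ι x`: then `ι (ι x) = ι x = x`
    rw [← hx, ← hx]
  · exact hx.symm

/-- The deck transformation is involutive. [cite: GompfStipsicz1999, §6.3] -/
theorem deck_involutive (h : IsBranchedDoubleCover IX X K ι q) : Involutive ι := h.deck_deck

/-- `ι ∘ ι = id` (the form used by route `ChargedHalfTurns`). [cite: GompfStipsicz1999, §6.3] -/
theorem deck_comp_deck (h : IsBranchedDoubleCover IX X K ι q) : ι ∘ ι = id :=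
  funext h.deck_deck

/-- The deck transformation is a bijection. [cite: GompfStipsicz1999, §6.3] -/
theorem deck_bijective (h : IsBranchedDoubleCover IX X K ι q) : Bijective ι :=
  h.deck_involutive.bijective

/-- The fibre of `q` through `x` is exactly `{x, ι x}`. [cite: GompfStipsicz1999, §6.3] -/
theorem proj_eq_iff (h : IsBranchedDoubleCover IX X K ι q) {x y : X} :
    q y = q x ↔ y = x ∨ y = ι x := by
  refine ⟨h.eq_or_eq_deck_of_proj_eq x y, ?_⟩
  rintro (rfl | rfl)
  · rfl
  · exact h.proj_deck _

/-- The projection is continuous. [folklore] -/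
theorem continuous_proj (h : IsBranchedDoubleCover IX X K ι q) : Continuous q :=
  h.contMDiff_proj.continuous

/-- The deck transformation is continuous. [folklore] -/
theorem continuous_deck (h : IsBranchedDoubleCover IX X K ι q) : Continuous ι :=
  h.contMDiff_deck.continuous

/-- **The fixed points of the deck involution are exactly the points over the knot**:
`ι x = x ↔ q x ∈ K(S²)`. (`→`: off the knot `ι` is free. `←`: a point over `K p = ν (p, 0)` lies in
the model piece, `x = j (p', w)` with `ν (p', w²) = ν (p, 0)`, so `w² = 0`, `w = 0`, and
`ι x = j (p', -0) = x`.) Gompf–Stipsicz (1999), §6.3; Kuhrman (2025), §2.2 ("`K̃` … the fixed point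
set of `ι_K`"). [cite: GompfStipsicz1999, §6.3] -/
theorem isFixedPt_iff (h : IsBranchedDoubleCover IX X K ι q) (x : X) :
    ι x = x ↔ q x ∈ range K := by
  constructor
  · intro hx
    by_contra hK
    exact h.deck_ne_of_notMem x hK hx
  · rintro ⟨p, hp⟩
    obtain ⟨ν, j, hj, -, hqj, hιj, hrange⟩ := h.exists_model
    have hxν : x ∈ q ⁻¹' range ν.toFun := ⟨(p, 0), by rw [ν.apply_zero, hp]⟩
    rw [← hrange] at hxν
    obtain ⟨⟨p', w⟩, rfl⟩ := hxν
    have hw : normalSq w = 0 := by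
      have h1 : ν.toFun (p', normalSq w) = ν.toFun (p, 0) := by
        rw [← hqj, ← hp, ν.apply_zero]
      exact (Prod.mk.inj (ν.injective h1)).2
    rw [normalSq_eq_zero_iff] at hw
    subst hw
    rw [hιj, neg_zero]

/-- Over the knot the fibre is a single point: if `q x ∈ K(S²)` and `q y = q x` then `y = x`.
[cite: GompfStipsicz1999, §6.3] -/
theorem eq_of_proj_eq_of_mem (h : IsBranchedDoubleCover IX X K ι q) {x y : X}
    (hx : q x ∈ range K) (hy : q y = q x) : y = x := by
  rcases h.eq_or_eq_deck_of_proj_eq x y hy with rfl | rfl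
  · rfl
  · exact (h.isFixedPt_iff x).2 hx

/-- Off the knot the fibre has exactly two points: `ι x ≠ x` and `q⁻¹ {q x} = {x, ι x}`.
[cite: GompfStipsicz1999, §6.3] -/
theorem preimage_singleton_eq (h : IsBranchedDoubleCover IX X K ι q) (x : X) :
    q ⁻¹' {q x} = {x, ι x} := by
  ext y
  simp only [mem_preimage, mem_singleton_iff, mem_insert_iff]
  exact h.proj_eq_iff

/-- The knot lies in the image of the fixed-point set: `K p = q x` for some fixed point `x`.
[cite: GompfStipsicz1999, §6.3] -/
theorem exists_isFixedPt_proj_eq (h : IsBranchedDoubleCover IX X K ι q) (p : 𝕊 2) :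
    ∃ x, ι x = x ∧ q x = K p := by
  obtain ⟨x, hx⟩ := h.proj_surjective (K p)
  exact ⟨x, (h.isFixedPt_iff x).2 ⟨p, hx.symm⟩, hx⟩

section FixedSphere

variable [FiniteDimensional ℝ EX] [IX.Boundaryless] [IsManifold IX ∞ X] [T2Space X]

/-- **The fixed-point set of the deck involution is a smoothly embedded 2-sphere lifting the
knot** (the planner's `FixedSphere`; Kuhrman (2025), §2.2: the fixed point set `K̃` of the
branching involution is the lift of the knot; Gompf–Stipsicz (1999), §6.3). Precisely: there is
a `C^∞` embedding `e : S² ↪ X` (in Mathlib's chart sense `Manifold.IsSmoothEmbedding`) with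
`Fix ι = e(S²)` and `q ∘ e = K`. Proof: `e p = j (p, 0)` in the model piece; it is injective with
injective differential (`d j` is injective as `j` is an immersion —
`mfderiv_injective_of_isImmersion` — and `p ↦ (p, 0)` has differential `inl`), hence a smooth
embedding of the compact `S²` into the Hausdorff `X` (`isSmoothEmbedding_of_injective_of_
injective_mfderiv`, Hirsch Ch. 1 §3 Thm. 3.1); `Fix ι = e(S²)` by `isFixedPt_iff` and the model.
Stated for a boundaryless finite-dimensional model `IX` (e.g. `𝓡 4`), `X` Hausdorff.
[cite: GompfStipsicz1999, §6.3] -/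
theorem exists_isSmoothEmbedding_fixedPoints (h : IsBranchedDoubleCover IX X K ι q) :
    ∃ e : (𝕊 2) → X, Manifold.IsSmoothEmbedding (𝓡 2) IX ∞ e ∧
      (∀ x, ι x = x ↔ x ∈ range e) ∧ ∀ p, q (e p) = K p := by
  obtain ⟨ν, j, hj, -, hqj, hιj, hrange⟩ := h.exists_model
  have hjinj : Injective j := hj.isEmbedding.injective
  refine ⟨fun p => j (p, 0), ?_, fun x => ?_, fun p => by rw [hqj, normalSq_zero, ν.apply_zero]⟩
  · -- smooth embedding: injective immersion of the compact sphere
    have hslice : ContMDiff (𝓡 2) ((𝓡 2).prod 𝓘(ℝ, 𝔼 2)) ∞ fun p : 𝕊 2 => (p, (0 : 𝔼 2)) :=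
      contMDiff_id.prodMk contMDiff_const
    have hsmooth : ContMDiff (𝓡 2) IX ∞ fun p : 𝕊 2 => j (p, 0) := hj.contMDiff.comp hslice
    refine isSmoothEmbedding_of_injective_of_injective_mfderiv hsmooth (by exact_mod_cast le_top)
      (fun p p' hpp' => (Prod.mk.inj (hjinj hpp')).1) fun p => ?_
    have hjd : MDifferentiableAt ((𝓡 2).prod 𝓘(ℝ, 𝔼 2)) IX j (p, 0) :=
      hj.contMDiff.mdifferentiableAt (by simp)
    have hsd : MDifferentiableAt (𝓡 2) ((𝓡 2).prod 𝓘(ℝ, 𝔼 2)) (fun p : 𝕊 2 => (p, (0 : 𝔼 2))) p :=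
      hslice.mdifferentiableAt (by simp)
    have hcomp := mfderiv_comp p hjd hsd
    rw [show (fun p : 𝕊 2 => j (p, 0)) = j ∘ fun p : 𝕊 2 => (p, (0 : 𝔼 2)) from rfl, hcomp,
      mfderiv_prod_left]
    have hinj : Injective (mfderiv ((𝓡 2).prod 𝓘(ℝ, 𝔼 2)) IX j (p, 0)) :=
      mfderiv_injective_of_isImmersion hj.isImmersion (by exact_mod_cast le_top) _
    intro v v' hvv'
    exact congrArg Prod.fst (hinj hvv')
  · -- `Fix ι = e(S²)`
    constructor
    · intro hx
      have hK : q x ∈ range K := (h.isFixedPt_iff x).1 hx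
      have hxν : x ∈ q ⁻¹' range ν.toFun := ν.range_subset_range hK
      rw [← hrange] at hxν
      obtain ⟨⟨p', w⟩, rfl⟩ := hxν
      have hw : w = 0 := (model_isFixedPt_iff hjinj hιj p' w).1 hx
      subst hw
      exact ⟨p', rfl⟩
    · rintro ⟨p, rfl⟩
      exact (model_isFixedPt_iff hjinj hιj p 0).2 rfl

end FixedSphere

end IsBranchedDoubleCover

end Literature.Topology.FourManifolds
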